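import Summits.QuantumFields.BalabanUV.T4Continuum.Support.GradedWellUnitRows
import Summits.QuantumFields.BalabanUV.T4Continuum.Support.GradedWellSlice

/-!
# T⁴ programme, spine node NE2 (U1a), sub-row Δ1 — THE GRADED WELL, supplier brick «GW-V» file B2: THE TWO SUB-CONTOUR FAMILIES OF A UNIT CONTOUR
# (scales `s_i ∣ n`, the level-1 / level-2 sub-anchors `z + s₁·o + q·s₁·e_μ (+ s₂·o′ + q′·s₂·e_μ)`, their unit blocks, injectivity at fixed longitudinal index)

NE2 leaf prover 07, GEN 11 (`b2b-balaban-t4-ne2-formalise-leaf-07-g11`, numerics desk of sub-row Δ1), supplier brick «GW-V» for the row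
owner's GRADED WELL (R47 journal 2026-08-21 l.25022; objects `GradedSubBlocks` p244783 / `GradedWellData` p244847; offer l.25494; numerics:
memo `t4/T4-EST-NE2-D1-COLLAR.md` v1.1 §9.1b, job j114873 — `V = Q_GWᴴQ_GW − a·n^d·Q_⊤ᴴQ_⊤ ⪰ 0` to rounding for the typed `RowV`, FALSE for
the anchor-rule rows).

 * §4 `lev_dvd_fine` (`sGW_dvd_lev`, `sGW_dvd_sGW` are `GradedWellSlice`'s), `sGW_pos`, `lev_pos`, `lev_le_pow_mul_sGW`, `sGW_mul_div_lev`; §5 `subOne`, `subTwo`,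
   normal forms `subOne_eq` / `subOne_shift_eq` / `subTwo_eq` / `subTwo_shift_eq` (`= z + vecN (…)`), `blockOf_eq_of_transverse_lt`,
   `blockOf_unit_shift` (`blockOf (z + n·e_μ) = blockOf z + e_μ`), **`blockOf_subOne`** (`= blockOf z + ⌊(o_μ+q)/r₁⌋·e_μ`), `blockOf_subOne_shift`,
   **`blockOf_subTwo`**, `blockOf_subTwo_shift`, `natCast_inj_of_lt`, **`subOne_inj`**, **`subTwo_inj`** (mixed radix).

HONEST FRAMING (T4-DAG p. 1).  [folklore] finite-torus combinatorics, Cauchy–Schwarz and bookkeeping on OUR model objects (U = 1, a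
layer map on unit blocks, `m` fixed, finite torus); no estimate of Bałaban's is asserted, certified or disputed; NE2 (U1a) NOT proved; spine
PROVED 0/9 unchanged; NOT [B9] (3.16)/(3.23)–(3.27)/(3.42) as printed; NOT infinite volume / mass gap / Clay.  HONEST DEPENDENCY: continuum
YM on T⁴ ⇐ BetaPertH ∧ nine spine estimates (0/9 proved); BetaPertH ⇐ (D1) ∧ (D4) ∧ CAP+tail; G-an2-4 gates asym, D1 and NE2/3/4.  No `sorry`.
-/

noncomputable section

open scoped BigOperators ComplexConjugate Matrix
open Finset

namespace Summit.QuantumFields.BalabanUV.T4Continuum.GradedWellUnitMass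

open Literature.MathematicalPhysics.QuantumFieldTheory.Balaban1983to89.B5Prop11Plancherel (Tor fine unitVec)
open Literature.MathematicalPhysics.QuantumFieldTheory.Balaban1983to89.B5Prop11Lower (nsq nsq_nonneg)
open Literature.MathematicalPhysics.QuantumFieldTheory.Balaban1983to89.B5Block118 (tstep tstep_zero tstep_succ)
open Literature.MathematicalPhysics.QuantumFieldTheory.Balaban1983to89.B5Blocks16 (blockOf)
open Literature.MathematicalPhysics.QuantumFieldTheory.Balaban1983to89.B5G183RateUnitTower (lev lev_neZero)
open Summit.QuantumFields.BalabanUV.T4Continuum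
open Summit.QuantumFields.BalabanUV.T4Continuum.ScalarPlantingDefect (val_blockOf)
open Summit.QuantumFields.BalabanUV.T4Continuum.GradedSubBlocks (Anchor Anc InSub site meanS avgS avgS_mulVec s_pos site_add
  val_site anchor_add_tstep shiftAnc)
open Literature.MathematicalPhysics.QuantumFieldTheory.Balaban1983to89.B5Composition116 (tstep_add)
open Summit.QuantumFields.BalabanUV.T4Continuum.GradedContourRefine (subAnc subAnc_val mulOff mulOff_val norm_sq_avgS_le
  anchor_of_dvd mul_lt_of_lt_div)
open Summit.QuantumFields.BalabanUV.T4Continuum.GradedWellData (sGW sGW_dvd wGW wGW_sq wGW_nonneg TorK RowV QvGW lev_eq_pow)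
open Summit.QuantumFields.BalabanUV.T4Continuum.GradedWellSlice (sGW_dvd_lev sGW_dvd_sGW)

variable {d : ℕ}

/-! ## §4 Scales of the graded well: divisibilities and ratios -/

section Scales

variable (L : ℕ) [NeZero L] (M : Fin d → ℕ) [hM : ∀ μ, NeZero (M μ)] (k : ℕ)

omit [NeZero L] hM in
/-- the unit scale divides the periods: `n ∣ n·M_ν`. [folklore] -/
theorem lev_dvd_fine (ν : Fin d) : lev L k ∣ fine (lev L k) M ν := Dvd.intro _ rfl

-- `sGW_dvd_lev` / `sGW_dvd_sGW` (`s_i ∣ n`, `s_{i'} ∣ s_i`) are the owner's (`GradedWellSlice`), reused.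

omit hM in
/-- `0 < s_i`. [folklore] -/
theorem sGW_pos (i : ℕ) : 0 < sGW L k i := Nat.pos_of_ne_zero (NeZero.ne _)

omit hM in
/-- `0 < n`. [folklore] -/
theorem lev_pos : 0 < lev L k := Nat.pos_of_ne_zero (NeZero.ne _)

omit [NeZero L] hM in
/-- the weight dominates the geometric ratio: `(n/s_i)²·s_i^d ≤ w_i² = L^{2i}·s_i^d`, i.e. `n ≤ L^i·s_i` (equality for `i ≤ k`). [folklore] -/
theorem lev_le_pow_mul_sGW (hL : 1 ≤ L) (i : ℕ) : lev L k ≤ L ^ i * sGW L k i := by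
  show lev L k ≤ L ^ i * lev L (k - i)
  rw [lev_eq_pow, lev_eq_pow, ← pow_add]
  exact Nat.pow_le_pow_right hL (by omega)

omit hM in
/-- `s_i·c / n = c / r` with `r = n / s_i`. [folklore] -/
theorem sGW_mul_div_lev (i c : ℕ) : sGW L k i * c / lev L k = c / (lev L k / sGW L k i) := by
  conv_lhs => rw [show lev L k = sGW L k i * (lev L k / sGW L k i) from (Nat.mul_div_cancel' (sGW_dvd_lev L k i)).symm]
  exact Nat.mul_div_mul_left _ _ (sGW_pos L k i)

end Scales

/-! ## §5 The two sub-anchor families of a unit contour and their unit blocks -/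

section Sub

variable (L : ℕ) [NeZero L] (M : Fin d → ℕ) [hM : ∀ μ, NeZero (M μ)] (k : ℕ)

omit [NeZero L] hM in
/-- pointwise-equal offsets give the same torus vector. [folklore] -/
theorem vecN_congr' {v w : Fin d → ℕ} (h : ∀ ν, v ν = w ν) : vecN (fine (lev L k) M) v = vecN (fine (lev L k) M) w := by
  rw [funext h]

/-- LEVEL 1: the scale-`s_{i₁}` sub-anchors `z + s·o + q·s·e_μ` of the unit contour `(z, μ)`. [folklore] -/
def subOne (i₁ : ℕ) (z : Anc (fine (lev L k) M) (lev L k)) (μ : Fin d)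
    (o : Fin d → Fin (lev L k / sGW L k i₁)) (q : Fin (lev L k / sGW L k i₁)) : Anc (fine (lev L k) M) (sGW L k i₁) :=
  subAnc (fine (lev L k) M) (lev L k) (sGW L k i₁) (lev_dvd_fine L M k) (sGW_dvd L M k i₁) (sGW_dvd_lev L k i₁) z μ o q

/-- LEVEL 2: the scale-`s_{i₂}` sub-anchors of the level-1 sub-contour (`i₁ ≤ i₂`). [folklore] -/
def subTwo {i₁ i₂ : ℕ} (h : i₁ ≤ i₂) (z : Anc (fine (lev L k) M) (lev L k)) (μ : Fin d)
    (o : Fin d → Fin (lev L k / sGW L k i₁)) (q : Fin (lev L k / sGW L k i₁))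
    (o' : Fin d → Fin (sGW L k i₁ / sGW L k i₂)) (q' : Fin (sGW L k i₁ / sGW L k i₂)) : Anc (fine (lev L k) M) (sGW L k i₂) :=
  subAnc (fine (lev L k) M) (sGW L k i₁) (sGW L k i₂) (sGW_dvd L M k i₁) (sGW_dvd L M k i₂) (sGW_dvd_sGW L k h)
    (subOne L M k i₁ z μ o q) μ o' q'

/-- normal form of the level-1 sub-anchor: `z + vecN (s·o + q·s·δ_μ)`. [folklore] -/
theorem subOne_eq (i₁ : ℕ) (z : Anc (fine (lev L k) M) (lev L k)) (μ : Fin d)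
    (o : Fin d → Fin (lev L k / sGW L k i₁)) (q : Fin (lev L k / sGW L k i₁)) :
    (subOne L M k i₁ z μ o q).1
      = z.1 + vecN (fine (lev L k) M) (fun ν => sGW L k i₁ * (o ν : ℕ) + if ν = μ then (q : ℕ) * sGW L k i₁ else 0) := by
  rw [subOne, subAnc_val, site_eq_add_vecN, tstep_eq_vecN, add_assoc, vecN_add]
  rfl

/-- the level-1 endpoint: `+ s·e_μ` adds `s` to the `μ`-coordinate of the offset. [folklore] -/
theorem subOne_shift_eq (i₁ : ℕ) (z : Anc (fine (lev L k) M) (lev L k)) (μ : Fin d)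
    (o : Fin d → Fin (lev L k / sGW L k i₁)) (q : Fin (lev L k / sGW L k i₁)) :
    (subOne L M k i₁ z μ o q).1 + tstep (fine (lev L k) M) μ (sGW L k i₁)
      = z.1 + vecN (fine (lev L k) M) (fun ν => sGW L k i₁ * (o ν : ℕ) + if ν = μ then ((q : ℕ) + 1) * sGW L k i₁ else 0) := by
  rw [subOne_eq, tstep_eq_vecN, add_assoc, vecN_add]
  congr 1
  apply vecN_congr' L M k
  intro ν
  by_cases h : ν = μ
  · subst h; simp only [if_true]; ring
  · simp only [h, if_false, add_zero]

/-- normal form of the level-2 sub-anchor: `z + vecN (s₁·o + s₂·o′ + (q·s₁ + q′·s₂)·δ_μ)`. [folklore] -/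
theorem subTwo_eq {i₁ i₂ : ℕ} (h : i₁ ≤ i₂) (z : Anc (fine (lev L k) M) (lev L k)) (μ : Fin d)
    (o : Fin d → Fin (lev L k / sGW L k i₁)) (q : Fin (lev L k / sGW L k i₁))
    (o' : Fin d → Fin (sGW L k i₁ / sGW L k i₂)) (q' : Fin (sGW L k i₁ / sGW L k i₂)) :
    (subTwo L M k h z μ o q o' q').1
      = z.1 + vecN (fine (lev L k) M) (fun ν => sGW L k i₁ * (o ν : ℕ) + sGW L k i₂ * (o' ν : ℕ)
          + if ν = μ then (q : ℕ) * sGW L k i₁ + (q' : ℕ) * sGW L k i₂ else 0) := by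
  rw [subTwo, subAnc_val, subOne_eq, site_eq_add_vecN, tstep_eq_vecN, add_assoc, add_assoc, vecN_add, vecN_add]
  congr 1
  apply vecN_congr' L M k
  intro ν
  simp only [mulOff_val]
  by_cases hν : ν = μ
  · subst hν; simp only [if_true]; ring
  · simp only [hν, if_false, add_zero]

/-- the level-2 endpoint. [folklore] -/
theorem subTwo_shift_eq {i₁ i₂ : ℕ} (h : i₁ ≤ i₂) (z : Anc (fine (lev L k) M) (lev L k)) (μ : Fin d)
    (o : Fin d → Fin (lev L k / sGW L k i₁)) (q : Fin (lev L k / sGW L k i₁))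
    (o' : Fin d → Fin (sGW L k i₁ / sGW L k i₂)) (q' : Fin (sGW L k i₁ / sGW L k i₂)) :
    (subTwo L M k h z μ o q o' q').1 + tstep (fine (lev L k) M) μ (sGW L k i₂)
      = z.1 + vecN (fine (lev L k) M) (fun ν => sGW L k i₁ * (o ν : ℕ) + sGW L k i₂ * (o' ν : ℕ)
          + if ν = μ then (q : ℕ) * sGW L k i₁ + ((q' : ℕ) + 1) * sGW L k i₂ else 0) := by
  rw [subTwo_eq, tstep_eq_vecN, add_assoc, vecN_add]
  congr 1
  apply vecN_congr' L M k
  intro ν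
  by_cases hν : ν = μ
  · subst hν; simp only [if_true]; ring
  · simp only [hν, if_false, add_zero]

/-- **UNIT BLOCK OF A POINT `z + vecN v` WITH SMALL TRANSVERSE OFFSET**: if `v_ν < n` for `ν ≠ μ` then
`blockOf (z + v) = blockOf z + ⌊v_μ/n⌋·e_μ`. [folklore] -/
theorem blockOf_eq_of_transverse_lt (z : Anc (fine (lev L k) M) (lev L k)) (μ : Fin d) (v : Fin d → ℕ)
    (hv : ∀ ν, ν ≠ μ → v ν < lev L k) :
    blockOf (lev L k) M (z.1 + vecN (fine (lev L k) M) v) = blockOf (lev L k) M z.1 + tstep M μ (v μ / lev L k) := by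
  rw [blockOf_anchor_add_vecN (lev L k) M z.2 v, vecN_eq_tstep M μ (fun ν => v ν / lev L k) (fun ν hν => Nat.div_eq_of_lt (hv ν hν))]

/-- the endpoint block of the unit contour: `blockOf (z + n·e_μ) = blockOf z + e_μ`. [folklore] -/
theorem blockOf_unit_shift (z : Anc (fine (lev L k) M) (lev L k)) (μ : Fin d) :
    blockOf (lev L k) M (z.1 + tstep (fine (lev L k) M) μ (lev L k)) = blockOf (lev L k) M z.1 + tstep M μ 1 := by
  rw [tstep_eq_vecN, blockOf_eq_of_transverse_lt L M k z μ _ (fun ν hν => by simp [hν, lev_pos L k])]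
  simp [Nat.div_self (lev_pos L k)]

/-- transverse offsets of level 1 are `< n`: `s·o_ν < n`. [folklore] -/
theorem sGW_mul_lt (i₁ : ℕ) (o : Fin d → Fin (lev L k / sGW L k i₁)) (ν : Fin d) : sGW L k i₁ * (o ν : ℕ) < lev L k :=
  mul_lt_of_lt_div (lev L k) (sGW L k i₁) (sGW_dvd_lev L k i₁) (o ν).isLt

/-- transverse offsets of level 2 are `< n`: `s₁·o_ν + s₂·o′_ν < n`. [folklore] -/
theorem sGW_mul_add_lt {i₁ i₂ : ℕ} (h : i₁ ≤ i₂) (o : Fin d → Fin (lev L k / sGW L k i₁))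
    (o' : Fin d → Fin (sGW L k i₁ / sGW L k i₂)) (ν : Fin d) :
    sGW L k i₁ * (o ν : ℕ) + sGW L k i₂ * (o' ν : ℕ) < lev L k := by
  have h1 : sGW L k i₂ * (o' ν : ℕ) < sGW L k i₁ :=
    mul_lt_of_lt_div (sGW L k i₁) (sGW L k i₂) (sGW_dvd_sGW L k h) (o' ν).isLt
  have h2 : sGW L k i₁ * ((o ν : ℕ) + 1) ≤ lev L k := by
    calc sGW L k i₁ * ((o ν : ℕ) + 1) ≤ sGW L k i₁ * (lev L k / sGW L k i₁) := Nat.mul_le_mul_left _ (o ν).isLt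
      _ = lev L k := Nat.mul_div_cancel' (sGW_dvd_lev L k i₁)
  calc sGW L k i₁ * (o ν : ℕ) + sGW L k i₂ * (o' ν : ℕ) < sGW L k i₁ * (o ν : ℕ) + sGW L k i₁ := Nat.add_lt_add_left h1 _
    _ = sGW L k i₁ * ((o ν : ℕ) + 1) := by ring
    _ ≤ lev L k := h2

/-- the unit block of a level-1 sub-anchor: `blockOf z + ⌊(o_μ + q)/r₁⌋·e_μ`, `r₁ = n/s`. [folklore] -/
theorem blockOf_subOne (i₁ : ℕ) (z : Anc (fine (lev L k) M) (lev L k)) (μ : Fin d)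
    (o : Fin d → Fin (lev L k / sGW L k i₁)) (q : Fin (lev L k / sGW L k i₁)) :
    blockOf (lev L k) M (subOne L M k i₁ z μ o q).1
      = blockOf (lev L k) M z.1 + tstep M μ (((o μ : ℕ) + q) / (lev L k / sGW L k i₁)) := by
  rw [subOne_eq, blockOf_eq_of_transverse_lt L M k z μ _ (fun ν hν => by simpa [hν] using sGW_mul_lt L k i₁ o ν)]
  congr 2
  simp only [if_true]
  rw [show sGW L k i₁ * (o μ : ℕ) + (q : ℕ) * sGW L k i₁ = sGW L k i₁ * ((o μ : ℕ) + q) by ring]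
  exact sGW_mul_div_lev L k i₁ _

/-- the unit block of the level-1 endpoint: `blockOf z + ⌊(o_μ + q + 1)/r₁⌋·e_μ`. [folklore] -/
theorem blockOf_subOne_shift (i₁ : ℕ) (z : Anc (fine (lev L k) M) (lev L k)) (μ : Fin d)
    (o : Fin d → Fin (lev L k / sGW L k i₁)) (q : Fin (lev L k / sGW L k i₁)) :
    blockOf (lev L k) M ((subOne L M k i₁ z μ o q).1 + tstep (fine (lev L k) M) μ (sGW L k i₁))
      = blockOf (lev L k) M z.1 + tstep M μ (((o μ : ℕ) + q + 1) / (lev L k / sGW L k i₁)) := by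
  rw [subOne_shift_eq, blockOf_eq_of_transverse_lt L M k z μ _ (fun ν hν => by simpa [hν] using sGW_mul_lt L k i₁ o ν)]
  congr 2
  simp only [if_true]
  rw [show sGW L k i₁ * (o μ : ℕ) + ((q : ℕ) + 1) * sGW L k i₁ = sGW L k i₁ * ((o μ : ℕ) + q + 1) by ring]
  exact sGW_mul_div_lev L k i₁ _

/-- the unit block of a level-2 sub-anchor: `blockOf z + ⌊(s₁(o_μ+q) + s₂(o′_μ+q′))/n⌋·e_μ`. [folklore] -/
theorem blockOf_subTwo {i₁ i₂ : ℕ} (h : i₁ ≤ i₂) (z : Anc (fine (lev L k) M) (lev L k)) (μ : Fin d)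
    (o : Fin d → Fin (lev L k / sGW L k i₁)) (q : Fin (lev L k / sGW L k i₁))
    (o' : Fin d → Fin (sGW L k i₁ / sGW L k i₂)) (q' : Fin (sGW L k i₁ / sGW L k i₂)) :
    blockOf (lev L k) M (subTwo L M k h z μ o q o' q').1
      = blockOf (lev L k) M z.1
          + tstep M μ ((sGW L k i₁ * ((o μ : ℕ) + q) + sGW L k i₂ * ((o' μ : ℕ) + q')) / lev L k) := by
  rw [subTwo_eq, blockOf_eq_of_transverse_lt L M k z μ _ (fun ν hν => by simpa [hν] using sGW_mul_add_lt L k h o o' ν)]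
  congr 2
  simp only [if_true]
  congr 1
  ring

/-- the unit block of the level-2 endpoint. [folklore] -/
theorem blockOf_subTwo_shift {i₁ i₂ : ℕ} (h : i₁ ≤ i₂) (z : Anc (fine (lev L k) M) (lev L k)) (μ : Fin d)
    (o : Fin d → Fin (lev L k / sGW L k i₁)) (q : Fin (lev L k / sGW L k i₁))
    (o' : Fin d → Fin (sGW L k i₁ / sGW L k i₂)) (q' : Fin (sGW L k i₁ / sGW L k i₂)) :
    blockOf (lev L k) M ((subTwo L M k h z μ o q o' q').1 + tstep (fine (lev L k) M) μ (sGW L k i₂))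
      = blockOf (lev L k) M z.1
          + tstep M μ ((sGW L k i₁ * ((o μ : ℕ) + q) + sGW L k i₂ * ((o' μ : ℕ) + q' + 1)) / lev L k) := by
  rw [subTwo_shift_eq, blockOf_eq_of_transverse_lt L M k z μ _ (fun ν hν => by simpa [hν] using sGW_mul_add_lt L k h o o' ν)]
  congr 2
  simp only [if_true]
  congr 1
  ring

/-! ### injectivity of the parametrisations at fixed longitudinal index -/

omit [NeZero L] in
/-- casting naturals `< n ≤ n·M_ν` into `ZMod (n·M_ν)` is injective. [folklore] -/
theorem natCast_inj_of_lt {ν : Fin d} {a b : ℕ} (ha : a < lev L k) (hb : b < lev L k)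
    (h : ((a : ℕ) : ZMod (fine (lev L k) M ν)) = (b : ZMod (fine (lev L k) M ν))) : a = b := by
  have hN : lev L k ≤ fine (lev L k) M ν := Nat.le_mul_of_pos_right _ (Nat.pos_of_ne_zero (NeZero.ne (M ν)))
  have h1 := congrArg ZMod.val h
  rwa [ZMod.val_natCast, ZMod.val_natCast, Nat.mod_eq_of_lt (lt_of_lt_of_le ha hN),
    Nat.mod_eq_of_lt (lt_of_lt_of_le hb hN)] at h1

/-- at fixed `q`, `o ↦ subOne o q` is injective. [folklore] -/
theorem subOne_inj (i₁ : ℕ) (z : Anc (fine (lev L k) M) (lev L k)) (μ : Fin d) (q : Fin (lev L k / sGW L k i₁)) :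
    Function.Injective (fun o : Fin d → Fin (lev L k / sGW L k i₁) => subOne L M k i₁ z μ o q) := by
  intro o o₂ h
  have h1 := congrArg Subtype.val h
  simp only [subOne_eq] at h1
  have h2 := add_left_cancel h1
  funext ν
  have h3 := congrFun h2 ν
  simp only [vecN, Nat.cast_add] at h3
  have h4 := add_right_cancel h3
  have h5 := natCast_inj_of_lt L M k (sGW_mul_lt L k i₁ o ν) (sGW_mul_lt L k i₁ o₂ ν) h4
  exact Fin.ext (Nat.eq_of_mul_eq_mul_left (sGW_pos L k i₁) h5)

/-- at fixed `(q, q′)`, `(o, o′) ↦ subTwo o q o′ q′` is injective. [folklore] -/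
theorem subTwo_inj {i₁ i₂ : ℕ} (h : i₁ ≤ i₂) (z : Anc (fine (lev L k) M) (lev L k)) (μ : Fin d)
    (q : Fin (lev L k / sGW L k i₁)) (q' : Fin (sGW L k i₁ / sGW L k i₂)) :
    Function.Injective (fun oo : (Fin d → Fin (lev L k / sGW L k i₁)) × (Fin d → Fin (sGW L k i₁ / sGW L k i₂)) =>
      subTwo L M k h z μ oo.1 q oo.2 q') := by
  rintro ⟨o, o'⟩ ⟨o₂, o₂'⟩ hh
  have h1 := congrArg Subtype.val hh
  simp only [subTwo_eq] at h1
  have h2 := add_left_cancel h1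
  have hc : ∀ ν, o ν = o₂ ν ∧ o' ν = o₂' ν := by
    intro ν
    have h3 := congrFun h2 ν
    simp only [vecN, Nat.cast_add] at h3
    have h4 := add_right_cancel h3
    rw [← Nat.cast_add, ← Nat.cast_add] at h4
    have h5 := natCast_inj_of_lt L M k (sGW_mul_add_lt L k h o o' ν) (sGW_mul_add_lt L k h o₂ o₂' ν) h4
    have hlt : ∀ oo : Fin d → Fin (sGW L k i₁ / sGW L k i₂), sGW L k i₂ * (oo ν : ℕ) < sGW L k i₁ := fun oo =>
      mul_lt_of_lt_div (sGW L k i₁) (sGW L k i₂) (sGW_dvd_sGW L k h) (oo ν).isLt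
    -- mixed radix (`Literature…RegevRoutine.divMod_unique` shape, inlined): `s·a + b = s·a₂ + b₂`, `b, b₂ < s` ⇒ `a = a₂`, `b = b₂`
    have hs1 : 0 < sGW L k i₁ := sGW_pos L k i₁
    have e1 : (o ν : ℕ) = (o₂ ν : ℕ) := by
      have q1 : (sGW L k i₁ * (o ν : ℕ) + sGW L k i₂ * (o' ν : ℕ)) / sGW L k i₁ = (o ν : ℕ) := by
        rw [Nat.mul_add_div hs1, Nat.div_eq_of_lt (hlt o'), add_zero]
      have q2 : (sGW L k i₁ * (o₂ ν : ℕ) + sGW L k i₂ * (o₂' ν : ℕ)) / sGW L k i₁ = (o₂ ν : ℕ) := by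
        rw [Nat.mul_add_div hs1, Nat.div_eq_of_lt (hlt o₂'), add_zero]
      rw [← q1, h5, q2]
    have e2 : sGW L k i₂ * (o' ν : ℕ) = sGW L k i₂ * (o₂' ν : ℕ) := by
      rw [e1] at h5
      exact Nat.add_left_cancel h5
    exact ⟨Fin.ext e1, Fin.ext (Nat.eq_of_mul_eq_mul_left (sGW_pos L k i₂) e2)⟩
  exact Prod.ext (funext fun ν => (hc ν).1) (funext fun ν => (hc ν).2)

end Sub

end Summit.QuantumFields.BalabanUV.T4Continuum.GradedWellUnitMass

end
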